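import Summits.NavierStokesRegularity.FluidComputer.PalasekTowerRegisterGlobalCoreFlux
import Summits.NavierStokesRegularity.FluidComputer.PalasekTowerRadialChildRelaxation
import Summits.NavierStokesRegularity.FluidComputer.PalasekTowerBurgersNumber
import Mathlib.Analysis.Complex.ExponentialBounds

/-!
# REGISTER v2.3″ (continued): the CORE LEDGER's ball radius `1/N_{k+1}` against the child core's
# Burgers radius `(λA_k)^{−1/2}` — the flux-form core clause for a Burgers / radial child core

Cell `ns-blowup`, seat `ns-blowup-ecbridge-8` (g8); evidence toward crux 19250 `HeredityFromTwo`, floor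
`stub_core_floors` (the `CoreLedger` clause of `ReadoutFloors`: a `C¹` closed loop of speed `≤ 8π/N_{k+1}`
in a ball of radius `1/N_{k+1}` carrying circulation `≥ c₁N_{k+1}^{β−2}`), in the MODEL lane «child core =
Burgers / radial strained eddy / Lundgren cross-section in the host strain `λA_k` at `ν = 1`, circulation on
the core-ledger scale `Γ = C·N_{k+1}^{β−2}`» of `PalasekTowerBurgersNumber` / `…RadialChildRelaxation` /
`…LundgrenChildLaws`. `PalasekTowerRegisterGlobalCoreFlux` (ns-palasek-19179-p2) turned the clause into a
FLUX FORM: normal vorticity `≥ c₁A_{k+1}/(4π)` on a disc of radius `1/N_{k+1}` ⇒ the clause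
(`coreClause_of_vorticityDisc`, rim circle wound four times). The one number that decides whether a
strain-equilibrated child core passes it is the **ledger-to-core area ratio**

  `x_k := λA_k/N_{k+1}² = λ·N_k^{β−2b}`   (`_coreRatio_eq`; exponent `β − 2b > 0` = Palasek's (3.2)),

the squared ratio of the ledger radius `1/N_{k+1}` to the Burgers radius `(λA_k)^{−1/2}` (up to `4`):

* §1 `palasekTowerBreakdown_coreRatio_eq`, `_coreRatio_gt` (`x_k > λ`), `_coreRatio_mul_A_succ`
  (`x_k·A_{k+1} = λA_k·N_{k+1}^{β−2}`: the Burgers child's axis vorticity `ΓλA_k/(4π)` is `C·x_k` flux units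
  `A_{k+1}/(4π)`);
* §2 BURGERS CHILD: `_burgersChild_vorticity_eq` (`ω(p) = C·x_k·e^{−λA_k r²/4}·A_{k+1}/(4π)`),
  **`_burgersChild_fluxForm_on_disc`** (`c₁ ≤ C·x_k·e^{−x_k/4}` ⇒ `ω ≥ c₁A_{k+1}/(4π)` on the ledger disc;
  sharp: `_burgersChild_vorticity_rim`), `_mul_exp_neg_quarter_le` (`x·e^{−x/4} ≤ 4/e`: the flux form needs
  `C ≥ (e/4)c₁` at every level and FAILS for fixed `C, λ` once `x_k` is large — `x_k → ∞` up the tower), and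
  **`palasekTowerBreakdown_burgersChild_coreClause`**: under `c₁ ≤ C·x_k·e^{−x_k/4}` the Burgers child
  `burgersVortex (λA_k) 1 (C·N_{k+1}^{β−2})` MEETS THE LEVEL-`(k+1)` CLAUSE OF `CoreLedger` verbatim (centre
  `0`, any schedule with `radius ≥ 0`);
* §3 RADIAL CHILD after the relaxation clock (`_radialChild_relaxation_clock`, tolerance `ε`):
  **`_radialChild_fluxForm_on_disc`** — `0 < c₁ ≤ (C·x_k/ν_t)(e^{−x_k/(4ν_t)} − ε)`, `Γ ≥ C·N_{k+1}^{β−2}`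
  ⇒ `ω(t, y) ≥ c₁A_{k+1}/(4π)` for `‖y‖ ≤ 1/N_{k+1}` (`ν_t = 1 − e^{−λA_k t}`);
* §4 wide rates, `k = 2`: `x_2 = λ·N_2^{1/10} ∈ (1.95λ, 1.96λ)` (`wide_coreRatio_two_bounds`), so at `λ = 1`
  the Burgers child passes the flux form — hence the level-3 clause, `_burgersChild_coreClause_wide_two` — as
  soon as **`C ≥ 1.01·c₁`** (the register's own demand on the loop is `C ≥ c₁`), far inside the band `C = P/N_2^{1/20} ∈ [14.2, 21.2]`
  of `PalasekTowerBurgersNumber`; the any-profile Chebyshev capture `_childCirculation_outside_le_of_budget…`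
  reads «outside the ledger disc ≤ 4Γρ/x_k» and certifies nothing at `k = 2` unless `λ > 4ρ/1.95`.

WHAT THIS IS NOT: not NS about any registered flow — the Burgers vortex and the strained eddies are exact
INFINITE-ENERGY flows, no registered stage; nothing is asserted about `ReadoutFloors`, `CoreLedger` of a
registered flow, or any crux; «child core = Burgers / radial eddy» is a MODEL identification. The flux form is
SUFFICIENT for the clause, not necessary (K57-W: the clause pins no winding number).

References: P. G. Saffman, *Vortex Dynamics*, CUP 1992, §13.1 (3)–(4) [cite: Saffman1992, §13.1 eq. (4)];
A. J. Majda, A. L. Bertozzi, CUP 2002, §1.6 (1.60)–(1.61), §2.3.3 Ex. 2.9 [cite: MajdaBertozziCUP2002, §1.6];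
S. Palasek, arXiv:2605.13827, §3.1, §3 (3.2) [cite: Palasek2026ElementaryModel, §3 (3.2)].
-/

noncomputable section

namespace Summit.NavierStokesRegularity.FluidComputer.PalasekTowerClayBridge

open Real Set MeasureTheory
open scoped RealInnerProductSpace
open Literature.Analysis.FluidPDE Literature.Analysis.FluidPDE.RadialEddy

/-! ### §1 The ledger-to-core area ratio `x_k = λA_k/N_{k+1}² = λN_k^{β−2b}` -/

/-- **`λA_k/N_{k+1}² = λ·N_k^{β−2b}`** (`A_k = N_k^β`, `N_{k+1} = N_k^b`): the squared ratio of the core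
ledger's radius `1/N_{k+1}` to the child's Burgers radius `(λA_k)^{−1/2}`. -/
theorem palasekTowerBreakdown_coreRatio_eq (R : TowerRates) (k : ℕ) (l : ℝ) :
    l * R.A k / R.N (k + 1) ^ 2 = l * R.N k ^ (R.β - 2 * R.b) := by
  have hN := R.N_pos k
  have h2 : R.N (k + 1) ^ 2 = R.N k ^ (2 * R.b) := by
    rw [R.N_succ k, ← Real.rpow_natCast, ← Real.rpow_mul hN.le]
    congr 1; push_cast; ring
  rw [h2, TowerRates.A, Real.rpow_sub hN, mul_div_assoc]

/-- Palasek's admissibility `2b < β` makes the exponent positive: `x_k > λ` for `λ > 0` (and `x_k → ∞`). -/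
theorem palasekTowerBreakdown_coreRatio_gt (R : TowerRates) (k : ℕ) {l : ℝ} (hl : 0 < l) :
    l < l * R.N k ^ (R.β - 2 * R.b) := by
  have hexp : 0 < R.β - 2 * R.b := by linarith [R.two_b_lt_β]
  have h1 : 1 < R.N k ^ (R.β - 2 * R.b) := Real.one_lt_rpow (R.one_lt_N k) hexp
  nlinarith

/-- **`x_k · A_{k+1} = λA_k · N_{k+1}^{β−2}`**: the Burgers child's axis vorticity `ΓλA_k/(4π)`,
`Γ = C·N_{k+1}^{β−2}`, is `C·x_k` times the flux unit `A_{k+1}/(4π)` of `coreClause_of_vorticityDisc`. -/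
theorem palasekTowerBreakdown_coreRatio_mul_A_succ (R : TowerRates) (k : ℕ) (l : ℝ) :
    l * R.N k ^ (R.β - 2 * R.b) * R.A (k + 1) = l * R.A k * R.N (k + 1) ^ (R.β - 2) := by
  have hN1 := R.N_pos (k + 1)
  rw [← palasekTowerBreakdown_coreRatio_eq, show R.A (k + 1) = R.N (k + 1) ^ R.β from rfl,
    Real.rpow_sub hN1, Real.rpow_two]
  field_simp

/-! ### §2 The Burgers child on the ledger disc -/

/-- The Burgers child's axial vorticity in flux units: for `Γ = C·N_{k+1}^{β−2}`, strain `λA_k`, `ν = 1`,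
`ω(p) = C·x_k·e^{−λA_k(p₀² + p₁²)/4}·A_{k+1}/(4π)`. [cite: Saffman1992, §13.1 eq. (3)] -/
theorem palasekTowerBreakdown_burgersChild_vorticity_eq (R : TowerRates) (k : ℕ) (l C : ℝ)
    (p : EuclideanSpace ℝ (Fin 3)) :
    burgersVorticity (l * R.A k) 1 (C * R.N (k + 1) ^ (R.β - 2)) p =
      C * (l * R.N k ^ (R.β - 2 * R.b)) * exp (-(l * R.A k * (p 0 ^ 2 + p 1 ^ 2) / 4)) *
        (R.A (k + 1) / (4 * π)) := by
  unfold burgersVorticity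
  simp only [mul_one]
  rw [show l * R.A k * (C * R.N (k + 1) ^ (R.β - 2)) = C * (l * R.A k * R.N (k + 1) ^ (R.β - 2)) by
    ring, ← palasekTowerBreakdown_coreRatio_mul_A_succ]
  ring

/-- `λA_k·r² ≤ x_k` on the ledger disc `r² ≤ 1/N_{k+1}²`. -/
private theorem strain_mul_sq_le_coreRatio (R : TowerRates) (k : ℕ) {l : ℝ} (hl : 0 < l) {s : ℝ}
    (hs : s ≤ 1 / R.N (k + 1) ^ 2) : l * R.A k * s ≤ l * R.N k ^ (R.β - 2 * R.b) := by
  rw [← palasekTowerBreakdown_coreRatio_eq]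
  have hγ : 0 < l * R.A k := mul_pos hl (R.A_pos k)
  calc l * R.A k * s ≤ l * R.A k * (1 / R.N (k + 1) ^ 2) := mul_le_mul_of_nonneg_left hs hγ.le
    _ = l * R.A k / R.N (k + 1) ^ 2 := by ring

/-- **THE BURGERS CHILD PASSES THE FLUX FORM ON THE LEDGER DISC IFF `c₁ ≤ C·x_k·e^{−x_k/4}`** (the «if»;
`C ≥ 0`): on `p₀² + p₁² ≤ 1/N_{k+1}²` the axial vorticity is `≥ C·x_k·e^{−x_k/4}·A_{k+1}/(4π) ≥ c₁A_{k+1}/(4π)`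
— the hypothesis of `coreClause_of_vorticityDisc` at level `k + 1`. -/
theorem palasekTowerBreakdown_burgersChild_fluxForm_on_disc (R : TowerRates) (k : ℕ) {l C c₁ : ℝ}
    (hl : 0 < l) (hC : 0 ≤ C)
    (hP : c₁ ≤ C * (l * R.N k ^ (R.β - 2 * R.b)) * exp (-(l * R.N k ^ (R.β - 2 * R.b)) / 4))
    {p : EuclideanSpace ℝ (Fin 3)} (hp : p 0 ^ 2 + p 1 ^ 2 ≤ 1 / R.N (k + 1) ^ 2) :
    c₁ * R.A (k + 1) / (4 * π) ≤ burgersVorticity (l * R.A k) 1 (C * R.N (k + 1) ^ (R.β - 2)) p := by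
  rw [palasekTowerBreakdown_burgersChild_vorticity_eq]
  set x : ℝ := l * R.N k ^ (R.β - 2 * R.b) with hx
  have hx0 : 0 ≤ x := mul_nonneg hl.le (Real.rpow_pos_of_pos (R.N_pos k) _).le
  have hunit : 0 ≤ R.A (k + 1) / (4 * π) := div_nonneg (R.A_pos _).le (by positivity)
  have hexp : exp (-x / 4) ≤ exp (-(l * R.A k * (p 0 ^ 2 + p 1 ^ 2) / 4)) := by
    apply exp_le_exp.2
    have := strain_mul_sq_le_coreRatio R k hl hp
    rw [← hx] at this
    linarith
  calc c₁ * R.A (k + 1) / (4 * π) = c₁ * (R.A (k + 1) / (4 * π)) := by ring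
    _ ≤ C * x * exp (-x / 4) * (R.A (k + 1) / (4 * π)) := mul_le_mul_of_nonneg_right hP hunit
    _ ≤ C * x * exp (-(l * R.A k * (p 0 ^ 2 + p 1 ^ 2) / 4)) * (R.A (k + 1) / (4 * π)) :=
        mul_le_mul_of_nonneg_right (mul_le_mul_of_nonneg_left hexp (mul_nonneg hC hx0)) hunit

/-- **Sharpness at the rim**: at `p = (1/N_{k+1}, 0, 0)` the Burgers child's vorticity is exactly
`C·x_k·e^{−x_k/4}·A_{k+1}/(4π)` — so the flux form on the whole ledger disc holds iff `c₁ ≤ C·x_k·e^{−x_k/4}`. -/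
theorem palasekTowerBreakdown_burgersChild_vorticity_rim (R : TowerRates) (k : ℕ) (l C : ℝ) :
    burgersVorticity (l * R.A k) 1 (C * R.N (k + 1) ^ (R.β - 2))
        (EuclideanSpace.single (0 : Fin 3) (1 / R.N (k + 1))) =
      C * (l * R.N k ^ (R.β - 2 * R.b)) * exp (-(l * R.N k ^ (R.β - 2 * R.b)) / 4) *
        (R.A (k + 1) / (4 * π)) := by
  have h0 : (EuclideanSpace.single (0 : Fin 3) (1 / R.N (k + 1))) 0 = 1 / R.N (k + 1) := by simp
  have h1 : (EuclideanSpace.single (0 : Fin 3) (1 / R.N (k + 1))) 1 = 0 := by simp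
  rw [palasekTowerBreakdown_burgersChild_vorticity_eq, h0, h1, ← palasekTowerBreakdown_coreRatio_eq]
  congr 3
  ring

/-- `x·e^{−x/4} ≤ 4/e` for every real `x` (`1 + y ≤ e^y` at `y = x/4 − 1`): the flux form needs
`C ≥ (e/4)·c₁ > 0.679·c₁` at every level, whatever `λ`; and since `x·e^{−x/4} → 0`, for FIXED `C` it fails once
`x_k = λN_k^{β−2b}` is large (far up the tower: on wide rates `x_k = λN_k^{1/10}`). [folklore] -/
theorem palasekTowerBreakdown_mul_exp_neg_quarter_le (x : ℝ) : x * exp (-x / 4) ≤ 4 * exp (-1) := by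
  have h := add_one_le_exp (x / 4 - 1)
  have hsplit : exp (x / 4 - 1) = exp (x / 4) * exp (-1) := by rw [← Real.exp_add]; ring_nf
  have hinv : exp (-x / 4) = (exp (x / 4))⁻¹ := by rw [← Real.exp_neg]; ring_nf
  have hpos : 0 < exp (x / 4) := exp_pos _
  rw [hinv, ← div_eq_mul_inv, div_le_iff₀ hpos]
  nlinarith [exp_pos (-1 : ℝ)]

/-- **THE BURGERS CHILD MEETS THE LEVEL-`(k+1)` CORE CLAUSE OF `CoreLedger`** (any rates, any schedule with
`radius ≥ 0`; MODEL child `burgersVortex (λA_k) 1 (C·N_{k+1}^{β−2})` centred on the tower axis, `λ > 0`,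
`C ≥ 0`): if **`c₁ ≤ C·x_k·e^{−x_k/4}`**, `x_k = λN_k^{β−2b}`, then some `C¹` closed loop of speed `≤ 8π/N_{k+1}`
inside `closedBall x' (1/N_{k+1})`, `‖x'‖ ≤ radius`, carries circulation `≥ c₁N_{k+1}^{β−2}` in the child's
flow — the `(k+1)`-clause of `CoreLedger` verbatim (`coreClause_of_vorticityDisc`: the rim circle wound four
times; Stokes). [cite: MajdaBertozziCUP2002, §1.6] -/
theorem palasekTowerBreakdown_burgersChild_coreClause (R : TowerRates) (Sch : Schedule R)
    (hrad : 0 ≤ Sch.radius) (k : ℕ) {l C : ℝ} (hl : 0 < l) (hC : 0 ≤ C)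
    (hP : Sch.c₁ ≤ C * (l * R.N k ^ (R.β - 2 * R.b)) * exp (-(l * R.N k ^ (R.β - 2 * R.b)) / 4)) :
    ∃ (x' : EuclideanSpace ℝ (Fin 3)) (γ : ℝ → EuclideanSpace ℝ (Fin 3)),
      ‖x'‖ ≤ Sch.radius ∧ ContDiff ℝ 1 γ ∧ γ 0 = γ 1 ∧
      (∀ σ ∈ Icc (0 : ℝ) 1, γ σ ∈ Metric.closedBall x' (1 / R.N (k + 1))) ∧
      (∀ σ ∈ Icc (0 : ℝ) 1, ‖deriv γ σ‖ ≤ 8 * π / R.N (k + 1)) ∧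
      Sch.c₁ * R.N (k + 1) ^ (R.β - 2) ≤
        circulation (burgersVortex (l * R.A k) 1 (C * R.N (k + 1) ^ (R.β - 2))) γ := by
  set e₁ : EuclideanSpace ℝ (Fin 3) := EuclideanSpace.single 0 1 with he₁def
  set e₂ : EuclideanSpace ℝ (Fin 3) := EuclideanSpace.single 1 1 with he₂def
  have he₁ : ‖e₁‖ = 1 := by simp [he₁def]
  have he₂ : ‖e₂‖ = 1 := by simp [he₂def]
  have h12 : ⟪e₁, e₂⟫ = 0 := by simp [he₁def, he₂def, EuclideanSpace.inner_single_left]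
  have hcross : cross e₁ e₂ = EuclideanSpace.single 2 1 := by
    ext i
    fin_cases i <;>
      simp [he₁def, he₂def, cross, cross_apply, Matrix.cons_val_zero, Matrix.cons_val_one,
        Matrix.cons_val_two]
  have hN1 := R.N_pos (k + 1)
  refine coreClause_of_vorticityDisc Sch (k + 1) (contDiff_burgersVortex _ _ _) (x := 0)
    (by simpa using hrad) he₁ he₂ h12 fun ρ hρ θ => ?_
  rw [hcross, curl_burgersVortex, real_inner_smul_left]
  have hinner :
      ⟪(EuclideanSpace.single (2 : Fin 3) (1 : ℝ)), EuclideanSpace.single (2 : Fin 3) (1 : ℝ)⟫ = 1 := by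
    simp
  rw [hinner, mul_one]
  refine palasekTowerBreakdown_burgersChild_fluxForm_on_disc R k hl hC hP ?_
  have h0 : ((0 : EuclideanSpace ℝ (Fin 3)) + (ρ * cos θ) • e₁ + (ρ * sin θ) • e₂) 0 = ρ * cos θ := by
    simp [he₁def, he₂def]
  have h1 : ((0 : EuclideanSpace ℝ (Fin 3)) + (ρ * cos θ) • e₁ + (ρ * sin θ) • e₂) 1 = ρ * sin θ := by
    simp [he₁def, he₂def]
  rw [h0, h1]
  have hρ2 : ρ ^ 2 ≤ (1 / R.N (k + 1)) ^ 2 := pow_le_pow_left₀ hρ.1 hρ.2 2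
  calc (ρ * cos θ) ^ 2 + (ρ * sin θ) ^ 2 = ρ ^ 2 := by nlinarith [sin_sq_add_cos_sq θ]
    _ ≤ 1 / R.N (k + 1) ^ 2 := by rwa [one_div_pow] at hρ2

/-! ### §3 The radial child on the ledger disc, after the relaxation clock -/

variable {ω₀ : EuclideanSpace ℝ (Fin 2) → ℝ}

/-- **THE RADIAL CHILD PASSES THE FLUX FORM ON THE LEDGER DISC** (`ν = 1`, host strain `λA_k`; co-signed even
seed `ω₀ ≥ 0` with `Γ = ∫ω₀ ≥ C·N_{k+1}^{β−2}`, `C ≥ 0`, finite second moment; relaxation clock at tolerance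
`ε > 0` delivered at `t > 0`, `ν_t = 1 − e^{−λA_k t}`): if **`0 < c₁ ≤ (C·x_k/ν_t)·(e^{−x_k/(4ν_t)} − ε)`** then
`ω(t, y) ≥ c₁A_{k+1}/(4π)` at every `‖y‖ ≤ 1/N_{k+1}` — from the pointwise pinning
`|ω(t, ·) − ΓΦ_t| ≤ εΓλA_k/(4πν_t)` (`_radialChild_relaxation_clock`) and
`Φ_t(y) = (λA_k/(4πν_t))e^{−λA_k‖y‖²/(4ν_t)}`. (Late limit `ν_t → 1`: the Burgers condition with `e^{−x/4} − ε`.) -/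
theorem palasekTowerBreakdown_radialChild_fluxForm_on_disc (R : TowerRates) (k : ℕ) {l : ℝ}
    (hl : 0 < l) (hω₀ : Integrable ω₀) (h2 : Integrable fun y => ‖y‖ ^ 2 * |ω₀ y|)
    (heven : ∀ y, ω₀ (-y) = ω₀ y) (hnn : ∀ y, 0 ≤ ω₀ y) (hN : 0 < ∫ y, ω₀ y) {ε : ℝ} (hε : 0 < ε)
    {t : ℝ} (ht : 0 < t)
    (hclock : Real.log (1 + l * R.A k * (∫ y, ‖y‖ ^ 2 * |ω₀ y|) / (2 * ε * ∫ y, |ω₀ y|)) ≤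
      l * R.A k * t)
    {C c₁ : ℝ} (hC : 0 ≤ C) (hCΓ : C * R.N (k + 1) ^ (R.β - 2) ≤ ∫ y, ω₀ y) (hc₁ : 0 < c₁)
    (hP : c₁ ≤ C * (l * R.N k ^ (R.β - 2 * R.b)) / (1 - exp (-(l * R.A k * t))) *
      (exp (-(l * R.N k ^ (R.β - 2 * R.b)) / (4 * (1 - exp (-(l * R.A k * t))))) - ε))
    {y : EuclideanSpace ℝ (Fin 2)} (hy : ‖y‖ ≤ 1 / R.N (k + 1)) :
    c₁ * R.A (k + 1) / (4 * π) ≤ strainedEddyVorticity (l * R.A k) 1 ω₀ t y := by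
  have hγ : 0 < l * R.A k := mul_pos hl (R.A_pos k)
  have hπ : 0 < π := pi_pos
  have hN₁ : (∫ y, |ω₀ y|) = ∫ y, ω₀ y :=
    integral_congr_ae (Filter.Eventually.of_forall fun y => abs_of_nonneg (hnn y))
  have hN' : 0 < ∫ y, |ω₀ y| := by rw [hN₁]; exact hN
  have hdev := palasekTowerBreakdown_radialChild_relaxation_clock R k hl hω₀ h2 heven hN' hε ht hclock y
  rw [hN₁, burgersVortexKernel_zero_eq, one_mul] at hdev
  have hxA := palasekTowerBreakdown_coreRatio_mul_A_succ R k l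
  have hy2 : ‖y‖ ^ 2 ≤ 1 / R.N (k + 1) ^ 2 := by
    rw [← one_div_pow]; exact pow_le_pow_left₀ (norm_nonneg y) hy 2
  have hys := strain_mul_sq_le_coreRatio R k hl hy2
  set Γ : ℝ := ∫ y, ω₀ y with hΓ
  set νt : ℝ := 1 - exp (-(l * R.A k * t)) with hνt
  set x : ℝ := l * R.N k ^ (R.β - 2 * R.b) with hx
  have hνt0 : 0 < νt := by
    have : exp (-(l * R.A k * t)) < 1 := exp_lt_one_iff.2 (by nlinarith [mul_pos hγ ht])
    simp only [hνt]; linarith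
  have hx0 : 0 ≤ x := mul_nonneg hl.le (Real.rpow_pos_of_pos (R.N_pos k) _).le
  -- the bracket is positive (else `c₁ ≤ 0`)
  have hbr : 0 < exp (-x / (4 * νt)) - ε := by
    by_contra hle
    have : C * x / νt * (exp (-x / (4 * νt)) - ε) ≤ 0 :=
      mul_nonpos_of_nonneg_of_nonpos (by positivity) (not_lt.1 hle)
    linarith
  -- `Φ_t(y) ≥ (λA_k/(4πν_t)) e^{−x/(4ν_t)}` on the ledger disc
  have hexp : exp (-x / (4 * νt)) ≤ exp (-(l * R.A k * ‖y‖ ^ 2 / (4 * νt))) := by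
    apply exp_le_exp.2
    have h4 : 0 < 4 * νt := by positivity
    calc -x / (4 * νt) ≤ -(l * R.A k * ‖y‖ ^ 2) / (4 * νt) :=
          div_le_div_of_nonneg_right (neg_le_neg hys) h4.le
      _ = -(l * R.A k * ‖y‖ ^ 2 / (4 * νt)) := by rw [neg_div]
  have hK : 0 ≤ l * R.A k / (4 * π * νt) := by positivity
  -- the pinning, read from below
  have hlow : l * R.A k / (4 * π * νt) * exp (-(l * R.A k * ‖y‖ ^ 2 / (4 * νt))) * Γ -
      ε * (l * R.A k / (4 * π * νt) * Γ) ≤ strainedEddyVorticity (l * R.A k) 1 ω₀ t y := by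
    have := (abs_le.1 hdev).1
    linarith
  refine le_trans ?_ hlow
  have hA : 0 ≤ R.A (k + 1) / (4 * π) := div_nonneg (R.A_pos _).le (by positivity)
  calc c₁ * R.A (k + 1) / (4 * π)
      = c₁ * (R.A (k + 1) / (4 * π)) := by ring
    _ ≤ C * x / νt * (exp (-x / (4 * νt)) - ε) * (R.A (k + 1) / (4 * π)) :=
        mul_le_mul_of_nonneg_right hP hA
    _ = l * R.A k / (4 * π * νt) * (C * R.N (k + 1) ^ (R.β - 2)) * (exp (-x / (4 * νt)) - ε) := by
        rw [show l * R.A k / (4 * π * νt) * (C * R.N (k + 1) ^ (R.β - 2)) =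
            C * (l * R.A k * R.N (k + 1) ^ (R.β - 2)) / (4 * π * νt) by ring, ← hxA]
        ring
    _ ≤ l * R.A k / (4 * π * νt) * Γ * (exp (-x / (4 * νt)) - ε) :=
        mul_le_mul_of_nonneg_right (mul_le_mul_of_nonneg_left hCΓ hK) hbr.le
    _ ≤ l * R.A k / (4 * π * νt) * Γ * (exp (-(l * R.A k * ‖y‖ ^ 2 / (4 * νt))) - ε) :=
        mul_le_mul_of_nonneg_left (by linarith) (mul_nonneg hK hN.le)
    _ = _ := by ring

/-! ### §4 Wide rates, `k = 2` -/

/-- Lower dyadic bracket (copy of `PalasekTowerHeredityWitnessCalibration`'s). [folklore] -/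
private theorem lt_two_rpow_of_pow_lt' {x q : ℝ} {a m r : ℕ} (hq : q * r = (a * m : ℕ))
    (h : x ^ r < ((2 : ℝ) ^ a) ^ m) : x < (2 : ℝ) ^ q := by
  refine lt_of_pow_lt_pow_left₀ r (by positivity) ?_
  rwa [← Real.rpow_natCast ((2 : ℝ) ^ q) r, ← Real.rpow_mul (by norm_num), hq,
    Real.rpow_natCast, pow_mul]

/-- Upper dyadic bracket. [folklore] -/
private theorem two_rpow_lt_of_pow_lt' {x q : ℝ} (hx : 0 ≤ x) {a m r : ℕ}
    (hq : q * r = (a * m : ℕ)) (h : ((2 : ℝ) ^ a) ^ m < x ^ r) : (2 : ℝ) ^ q < x := by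
  refine lt_of_pow_lt_pow_left₀ r hx ?_
  rwa [← Real.rpow_natCast ((2 : ℝ) ^ q) r, ← Real.rpow_mul (by norm_num), hq,
    Real.rpow_natCast, pow_mul]

/-- `N_k = 2^{8·(11/10)^k}` on the wide rates. [folklore] -/
private theorem wide_N_two_rpow' (k : ℕ) :
    TowerRates.wide.N k = (2 : ℝ) ^ ((8 : ℝ) * (11 / 10) ^ k) := by
  simp only [TowerRates.N, TowerRates.wide]
  have h256 : (256 : ℝ) = (2 : ℝ) ^ (8 : ℝ) := by
    rw [show (8 : ℝ) = ((8 : ℕ) : ℝ) by norm_num, Real.rpow_natCast]; norm_num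
  rw [h256, ← Real.rpow_mul (by norm_num)]

/-- **`x_2 = λ·N_2^{1/10} ∈ (1.95λ, 1.96λ)` on the wide rates** (`β − 2b = 1/10`, `N_2 = 2^{242/25}`,
`N_2^{1/10} = 2^{121/125}`): at `k = 2` the ledger radius `1/N_3` is `(x_2/4)^{1/2} ≈ 0.70λ^{1/2}` Burgers
radii `2(λA_2)^{−1/2}`. [folklore] -/
theorem wide_coreRatio_two_bounds :
    1.95 < TowerRates.wide.N 2 ^ (TowerRates.wide.β - 2 * TowerRates.wide.b) ∧
      TowerRates.wide.N 2 ^ (TowerRates.wide.β - 2 * TowerRates.wide.b) < 1.96 := by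
  have hexp : TowerRates.wide.β - 2 * TowerRates.wide.b = 1 / 10 := by norm_num [TowerRates.wide]
  rw [hexp, wide_N_two_rpow', ← Real.rpow_mul (by norm_num)]
  exact ⟨lt_two_rpow_of_pow_lt' (a := 121) (m := 1) (r := 125) (by norm_num) (by norm_num),
    two_rpow_lt_of_pow_lt' (by norm_num) (a := 121) (m := 1) (r := 125) (by norm_num) (by norm_num)⟩

/-- **At `k = 2`, `λ = 1` (wide rates) the Burgers child passes the flux form as soon as `C ≥ 1.01·c₁`**
(`x_2 > 1.95`, `e^{−x_2/4} ≥ 1 − x_2/4 > 0.51`, `1.95·0.51·1.01 > 1`) — the threshold of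
`_burgersChild_fluxForm_on_disc` / `_burgersChild_coreClause` at `l = 1`. -/
theorem palasekTowerBreakdown_burgersChild_fluxForm_wide_two {C c₁ : ℝ} (hc₁ : 0 ≤ c₁)
    (hC : 1.01 * c₁ ≤ C) :
    c₁ ≤ C * (1 * TowerRates.wide.N 2 ^ (TowerRates.wide.β - 2 * TowerRates.wide.b)) *
      exp (-(1 * TowerRates.wide.N 2 ^ (TowerRates.wide.β - 2 * TowerRates.wide.b)) / 4) := by
  obtain ⟨hlo, hhi⟩ := wide_coreRatio_two_bounds
  rw [one_mul]
  set x : ℝ := TowerRates.wide.N 2 ^ (TowerRates.wide.β - 2 * TowerRates.wide.b) with hx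
  have he : -x / 4 + 1 ≤ exp (-x / 4) := add_one_le_exp _
  have he' : 0.51 ≤ exp (-x / 4) := by
    norm_num at he hhi ⊢
    linarith
  have hC0 : 0 ≤ C := by nlinarith
  have hx0 : 0 ≤ x := by linarith
  calc c₁ ≤ C * 1.95 * 0.51 := by nlinarith
    _ ≤ C * x * exp (-x / 4) :=
        mul_le_mul (mul_le_mul_of_nonneg_left hlo.le hC0) he' (by norm_num) (mul_nonneg hC0 hx0)

/-- **THE BURGERS CHILD OF THE SECOND HAND-OVER MEETS THE LEVEL-3 CORE CLAUSE** (wide rates, `λ = 1`, any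
schedule with `radius ≥ 0`): for every `C ≥ 1.01·c₁`, the Burgers vortex of circulation `C·N_3^{β−2}` in the
strain `A_2` at `ν = 1` carries a `CoreLedger`-admissible loop (ball radius `1/N_3`, speed `≤ 8π/N_3`) of
circulation `≥ c₁N_3^{β−2}`. MODEL statement; not about any registered flow. -/
theorem palasekTowerBreakdown_burgersChild_coreClause_wide_two (Sch : Schedule TowerRates.wide)
    (hrad : 0 ≤ Sch.radius) {C : ℝ} (hC : 1.01 * Sch.c₁ ≤ C) :
    ∃ (x' : EuclideanSpace ℝ (Fin 3)) (γ : ℝ → EuclideanSpace ℝ (Fin 3)),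
      ‖x'‖ ≤ Sch.radius ∧ ContDiff ℝ 1 γ ∧ γ 0 = γ 1 ∧
      (∀ σ ∈ Icc (0 : ℝ) 1, γ σ ∈ Metric.closedBall x' (1 / TowerRates.wide.N (2 + 1))) ∧
      (∀ σ ∈ Icc (0 : ℝ) 1, ‖deriv γ σ‖ ≤ 8 * π / TowerRates.wide.N (2 + 1)) ∧
      Sch.c₁ * TowerRates.wide.N (2 + 1) ^ (TowerRates.wide.β - 2) ≤
        circulation (burgersVortex (1 * TowerRates.wide.A 2) 1
          (C * TowerRates.wide.N (2 + 1) ^ (TowerRates.wide.β - 2))) γ :=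
  palasekTowerBreakdown_burgersChild_coreClause TowerRates.wide Sch hrad 2 one_pos
    (by linarith [Sch.c₁_pos]) (palasekTowerBreakdown_burgersChild_fluxForm_wide_two Sch.c₁_pos.le hC)

end Summit.NavierStokesRegularity.FluidComputer.PalasekTowerClayBridge

end
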